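import Literature.GroupTheory.CombinatorialGroupTheory.RibbonGraphEdgeDeletionCycles
import HarnessLib

/-!
# Deleting an edge of a one-vertex ribbon graph: the SPLIT case of the boundary cycles

Topic `Literature/GroupTheory/CombinatorialGroupTheory`; continues
`RibbonGraphEdgeDeletionCycles.lean` (same notation).  SPLIT (`h`, `h̄` on the same boundary cycle
`h, φ h, …, φ^p h, h̄, φ h̄, …, φ^q h̄`, `p, q ≥ 1`): after deleting `e` the darts `φ h, …, φ^p h`
and `φ h̄, …, φ^q h̄` form TWO cycles of `ψ = delFace ρ e` with words `U`, `V`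
(`split_minimalPeriod_true/false`, `split_prodFrom_true/false`, `split_sameCycle_true/false_iff`,
`split_not_sameCycle`, `split_cases`), while the old word was `e · U · e⁻¹ · V`
(`split_cycleProd_eq`).  Classical cutting of a ribbon graph along a non-separating edge
(Mohar–Thomassen §3.3; Zieschang–Vogt–Coldewey LNM 835 §3.2).  Theorems only.
-/

namespace Literature.GroupTheory.CombinatorialGroupTheory

namespace RibbonGraph

open Equiv Equiv.Perm Function

universe u

variable {E : Type u} [DecidableEq E] [Finite E] (ρ : Perm (Dart E)) (e : E)

/-! ### SPLIT: `h` and `h̄` on the same boundary cycle -/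

section Split

variable {ρ e} {p q : ℕ} (hper : minimalPeriod (face ρ) (e, true) = p + q + 2)
  (hhit : (face ρ ^ (p + 1)) (e, true) = (e, false)) (hp1 : 0 < p) (hq1 : 0 < q)

include hhit in
omit [DecidableEq E] [Finite E] in
/-- `split_pow_false`: bookkeeping lemma of this construction (see the module docstring). [cite: ZieschangVogtColdewey1980, 3.1.6 and 3.2.3] -/
theorem split_pow_false (k : ℕ) : (face ρ ^ k) (e, false) = (face ρ ^ (k + (p + 1))) (e, true) := by
  rw [pow_add, Perm.mul_apply, hhit]

include hper hhit

omit [DecidableEq E] in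
/-- `split_pow_true_fst_ne`: bookkeeping lemma of this construction (see the module docstring). [cite: ZieschangVogtColdewey1980, 3.1.6 and 3.2.3] -/
theorem split_pow_true_fst_ne {k : ℕ} (hk1 : 1 ≤ k) (hkp : k ≤ p) : ((face ρ ^ k) (e, true)).1 ≠ e := by
  rw [dart_fst_ne_iff]
  refine ⟨pow_apply_ne_of_lt_minimalPeriod _ hk1 (by omega), fun h => ?_⟩
  rw [← hhit] at h
  have := pow_apply_injOn_lt_minimalPeriod (face ρ) (x := (e, true)) (by omega) (by omega) h
  omega

omit [DecidableEq E] in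
/-- `split_pow_false_fst_ne`: bookkeeping lemma of this construction (see the module docstring). [cite: ZieschangVogtColdewey1980, 3.1.6 and 3.2.3] -/
theorem split_pow_false_fst_ne {k : ℕ} (hk1 : 1 ≤ k) (hkq : k ≤ q) : ((face ρ ^ k) (e, false)).1 ≠ e := by
  rw [dart_fst_ne_iff, split_pow_false hhit]
  refine ⟨pow_apply_ne_of_lt_minimalPeriod _ (by omega) (by omega), fun h => ?_⟩
  rw [← hhit] at h
  have := pow_apply_injOn_lt_minimalPeriod (face ρ) (x := (e, true)) (by omega) (by omega) h
  omega

omit [DecidableEq E] [Finite E] hhit in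
/-- `split_face_true_ne`: bookkeeping lemma of this construction (see the module docstring). [cite: ZieschangVogtColdewey1980, 3.1.6 and 3.2.3] -/
theorem split_face_true_ne : face ρ (e, true) ≠ (e, true) := by
  simpa using pow_apply_ne_of_lt_minimalPeriod (face ρ) (x := (e, true)) (k := 1) Nat.one_pos (by omega)

include hq1 in
omit [DecidableEq E] in
/-- `split_face_false_ne`: bookkeeping lemma of this construction (see the module docstring). [cite: ZieschangVogtColdewey1980, 3.1.6 and 3.2.3] -/
theorem split_face_false_ne : face ρ (e, false) ≠ (e, false) := by
  intro h
  have h' : (face ρ ^ (1 + (p + 1))) (e, true) = (face ρ ^ (p + 1)) (e, true) := by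
    rw [← split_pow_false hhit, pow_one, h, hhit]
  have := pow_apply_injOn_lt_minimalPeriod (face ρ) (x := (e, true)) (by omega) (by omega) h'
  omega

/-- SPLIT, the `P` side: `ψ` steps along `φ h, …, φ^p h` … [cite: ZieschangVogtColdewey1980, 3.1.6 and 3.2.3] -/
theorem delFace_splitP {k : ℕ} (hk : k + 1 < p) :
    delFace ρ e ((face ρ ^ (k + 1)) (e, true)) = (face ρ ^ (k + 1 + 1)) (e, true) := by
  have e3 : face ρ ((face ρ ^ (k + 1)) (e, true)) = (face ρ ^ (k + 1 + 1)) (e, true) := by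
    rw [← Perm.mul_apply, ← pow_succ']
  rw [← e3]
  refine delFace_apply_of_face_fst_ne ρ e (split_pow_true_fst_ne hper hhit (by omega) (by omega)) ?_
  rw [e3]; exact split_pow_true_fst_ne hper hhit (by omega) (by omega)

include hp1 in
/-- … and wraps around from `φ^p h` to `φ h`. [cite: ZieschangVogtColdewey1980, 3.1.6 and 3.2.3] -/
theorem delFace_splitP_last :
    delFace ρ e ((face ρ ^ (p - 1 + 1)) (e, true)) = (face ρ ^ (0 + 1)) (e, true) := by
  have e3 : face ρ ((face ρ ^ (p - 1 + 1)) (e, true)) = (e, false) := by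
    rw [← Perm.mul_apply, ← pow_succ', show p - 1 + 1 + 1 = p + 1 by omega, hhit]
  rw [zero_add, pow_one]
  exact (delFace_apply_of_face_eq_false ρ e (split_pow_true_fst_ne hper hhit (by omega) (by omega))
    e3).1 (split_face_true_ne hper)

/-- SPLIT, the `Q` side: `ψ` steps along `φ h̄, …, φ^q h̄` … [cite: ZieschangVogtColdewey1980, 3.1.6 and 3.2.3] -/
theorem delFace_splitQ {k : ℕ} (hk : k + 1 < q) :
    delFace ρ e ((face ρ ^ (k + 1)) (e, false)) = (face ρ ^ (k + 1 + 1)) (e, false) := by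
  have e3 : face ρ ((face ρ ^ (k + 1)) (e, false)) = (face ρ ^ (k + 1 + 1)) (e, false) := by
    rw [← Perm.mul_apply, ← pow_succ']
  rw [← e3]
  refine delFace_apply_of_face_fst_ne ρ e (split_pow_false_fst_ne hper hhit (by omega) (by omega)) ?_
  rw [e3]; exact split_pow_false_fst_ne hper hhit (by omega) (by omega)

include hq1 in
/-- … and wraps around from `φ^q h̄` to `φ h̄`. [cite: ZieschangVogtColdewey1980, 3.1.6 and 3.2.3] -/
theorem delFace_splitQ_last :
    delFace ρ e ((face ρ ^ (q - 1 + 1)) (e, false)) = (face ρ ^ (0 + 1)) (e, false) := by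
  have e3 : face ρ ((face ρ ^ (q - 1 + 1)) (e, false)) = (e, true) := by
    rw [← Perm.mul_apply, ← pow_succ', show q - 1 + 1 + 1 = q + 1 by omega, split_pow_false hhit,
      show q + 1 + (p + 1) = p + q + 2 by omega, ← hper]
    exact pow_minimalPeriod_perm _ _
  rw [zero_add, pow_one]
  exact (delFace_apply_of_face_eq_true ρ e (split_pow_false_fst_ne hper hhit (by omega) (by omega))
    e3).1 (split_face_false_ne hper hhit hq1)

include hp1 in
/-- SPLIT: the `ψ`-cycle of `φ h` has length `p` … [cite: ZieschangVogtColdewey1980, 3.1.6 and 3.2.3] -/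
theorem split_minimalPeriod_true : minimalPeriod (delFace ρ e) (face ρ (e, true)) = p := by
  have := minimalPeriod_eq_of_cyclicSeq (delFace ρ e) (fun k => (face ρ ^ (k + 1)) (e, true)) hp1
    (fun _ hk => delFace_splitP hper hhit hk) (delFace_splitP_last hper hhit hp1)
    (fun i j hi hj h => by
      have := pow_apply_injOn_lt_minimalPeriod (face ρ) (x := (e, true)) (by omega) (by omega) h
      omega)
  simpa using this

/-- … and word `U`. [cite: ZieschangVogtColdewey1980, 3.1.6 and 3.2.3] -/
theorem split_prodFrom_true :
    prodFrom (delFace ρ e) letter (face ρ (e, true)) p = prodFrom (face ρ) letter (face ρ (e, true)) p := by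
  have := prodFrom_eq_of_seq (delFace ρ e) letter (fun k => (face ρ ^ (k + 1)) (e, true))
    (fun _ hk => delFace_splitP hper hhit hk)
  rw [zero_add, pow_one] at this
  rw [this, prodFrom_apply_eq_ofFn]

include hp1 in
/-- … and consists of `φ h, …, φ^p h`. [cite: ZieschangVogtColdewey1980, 3.1.6 and 3.2.3] -/
theorem split_sameCycle_true_iff (y : Dart E) :
    (delFace ρ e).SameCycle (face ρ (e, true)) y ↔ ∃ k < p, (face ρ ^ (k + 1)) (e, true) = y := by
  have := sameCycle_iff_of_cyclicSeq (delFace ρ e) (fun k => (face ρ ^ (k + 1)) (e, true)) hp1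
    (fun _ hk => delFace_splitP hper hhit hk) (delFace_splitP_last hper hhit hp1)
    (fun i j hi hj h => by
      have := pow_apply_injOn_lt_minimalPeriod (face ρ) (x := (e, true)) (by omega) (by omega) h
      omega) y
  simpa using this

include hq1 in
/-- SPLIT: the `ψ`-cycle of `φ h̄` has length `q` … [cite: ZieschangVogtColdewey1980, 3.1.6 and 3.2.3] -/
theorem split_minimalPeriod_false : minimalPeriod (delFace ρ e) (face ρ (e, false)) = q := by
  have := minimalPeriod_eq_of_cyclicSeq (delFace ρ e) (fun k => (face ρ ^ (k + 1)) (e, false)) hq1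
    (fun _ hk => delFace_splitQ hper hhit hk) (delFace_splitQ_last hper hhit hq1)
    (fun i j hi hj h => by
      rw [split_pow_false hhit, split_pow_false hhit (j + 1)] at h
      have := pow_apply_injOn_lt_minimalPeriod (face ρ) (x := (e, true)) (by omega) (by omega) h
      omega)
  simpa using this

/-- … and word `V`. [cite: ZieschangVogtColdewey1980, 3.1.6 and 3.2.3] -/
theorem split_prodFrom_false :
    prodFrom (delFace ρ e) letter (face ρ (e, false)) q =
      prodFrom (face ρ) letter (face ρ (e, false)) q := by
  have := prodFrom_eq_of_seq (delFace ρ e) letter (fun k => (face ρ ^ (k + 1)) (e, false))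
    (fun _ hk => delFace_splitQ hper hhit hk)
  rw [zero_add, pow_one] at this
  rw [this, prodFrom_apply_eq_ofFn]

include hq1 in
/-- … and consists of `φ h̄, …, φ^q h̄`. [cite: ZieschangVogtColdewey1980, 3.1.6 and 3.2.3] -/
theorem split_sameCycle_false_iff (y : Dart E) :
    (delFace ρ e).SameCycle (face ρ (e, false)) y ↔ ∃ k < q, (face ρ ^ (k + 1)) (e, false) = y := by
  have := sameCycle_iff_of_cyclicSeq (delFace ρ e) (fun k => (face ρ ^ (k + 1)) (e, false)) hq1
    (fun _ hk => delFace_splitQ hper hhit hk) (delFace_splitQ_last hper hhit hq1)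
    (fun i j hi hj h => by
      rw [split_pow_false hhit, split_pow_false hhit (j + 1)] at h
      have := pow_apply_injOn_lt_minimalPeriod (face ρ) (x := (e, true)) (by omega) (by omega) h
      omega) y
  simpa using this

include hp1 hq1 in
/-- SPLIT: the two new cycles are distinct. [cite: ZieschangVogtColdewey1980, 3.1.6 and 3.2.3] -/
theorem split_not_sameCycle : ¬ (delFace ρ e).SameCycle (face ρ (e, true)) (face ρ (e, false)) := by
  rw [split_sameCycle_true_iff hper hhit hp1]
  rintro ⟨k, hk, h⟩
  rw [← pow_one (face ρ), split_pow_false hhit] at h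
  have := pow_apply_injOn_lt_minimalPeriod (face ρ) (x := (e, true)) (by omega) (by omega) h
  omega

include hp1 hq1 in
/-- SPLIT: every other dart of the old cycle lies on one of the two new cycles. [cite: ZieschangVogtColdewey1980, 3.1.6 and 3.2.3] -/
theorem split_cases {y : Dart E} (hy : y.1 ≠ e) (hs : (face ρ).SameCycle (e, true) y) :
    (delFace ρ e).SameCycle (face ρ (e, true)) y ∨ (delFace ρ e).SameCycle (face ρ (e, false)) y := by
  obtain ⟨j, hj, rfl⟩ := exists_lt_minimalPeriod_of_sameCycle _ hs
  rw [dart_fst_ne_iff] at hy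
  have hj0 : j ≠ 0 := by rintro rfl; exact hy.1 (by simp)
  have hjp : j ≠ p + 1 := by rintro rfl; exact hy.2 hhit
  by_cases hjle : j ≤ p
  · left
    rw [split_sameCycle_true_iff hper hhit hp1]
    exact ⟨j - 1, by omega, by rw [show j - 1 + 1 = j by omega]⟩
  · right
    rw [split_sameCycle_false_iff hper hhit hq1]
    refine ⟨j - p - 2, by omega, ?_⟩
    rw [split_pow_false hhit, show j - p - 2 + 1 + (p + 1) = j by omega]

omit [DecidableEq E] [Finite E] in
/-- SPLIT: the old word through `h` is `e · U · e⁻¹ · V`. [cite: ZieschangVogtColdewey1980, 3.1.6 and 3.2.3] -/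
theorem split_cycleProd_eq :
    cycleProd (face ρ) letter (e, true) =
      FreeGroup.of e * prodFrom (face ρ) letter (face ρ (e, true)) p *
        ((FreeGroup.of e)⁻¹ * prodFrom (face ρ) letter (face ρ (e, false)) q) := by
  rw [cycleProd, hper, show p + q + 2 = (p + 1) + (q + 1) by omega, prodFrom_add, hhit,
    prodFrom_succ, prodFrom_succ, letter_true, letter_false, mul_assoc]

end Split


end RibbonGraph

end Literature.GroupTheory.CombinatorialGroupTheory
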